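import Literature.Algebra.Homology.OrderedCechSystemAlternatingDifferential
import HarnessLib

/-!
# Refinement of ordered Čech cochains along an arbitrary index map, as a MORPHISM OF COMPLEXES (Stacks 01FG)

★ `Algebra/Homology/OrderedCechSystemAlternating(Differential)` define, for systems of `A`-modules `M` on `ι`, `M'` on `ι'`,
an index map `τ : ι' → ι` and refinement data `φ : imageFunctor τ ⋙ M ⟶ M'`, the linear refinement of ordered Čech cochains
`refineLinear τ φ n : Čⁿ(M) → Čⁿ(M')` (alternating extension along non-monotone `τ`) and prove that it commutes with the
differentials (`sysD_refineCochain`).  This file packages it as the morphism of cochain complexes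
**`refineComplexMap τ φ : sysComplex M ⟶ sysComplex M'`** (so that Mathlib's `HomologicalComplex.homologyMap` gives the
pull-back `τ^*` on ordered Čech classes), with its unfolding lemmas (`refineComplexMap_f`, `refineComplexMap_f_apply` — the
«characterised cochain map» hypothesis of the class-level theorems downstream) and the elementwise forms on cycles and classes
(`iCycles_cyclesMap_refineComplexMap`, `homologyπ_refineComplexMap`).  One definition; pure homological algebra over ★ files.
[cite: StacksProject, Tag 01FG] [cite: GortzWedhorn2023, Def. 21.68 (p. 180)]
-/

universe v u

open CategoryTheory HomologicalComplex

set_option backward.isDefEq.respectTransparency false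

noncomputable section

namespace Literature.Algebra.Homology

namespace OrderedCech

variable {ι ι' : Type} [LinearOrder ι] [LinearOrder ι'] {A : Type u} [CommRing A]
  {M : Finset ι ⥤ ModuleCat.{v} A} {M' : Finset ι' ⥤ ModuleCat.{v} A} (τ : ι' → ι) (φ : imageFunctor τ ⋙ M ⟶ M')

/-- **The refinement `Č(M) ⟶ Č(M')` along an index map `τ` with data `φ`, as a morphism of cochain complexes** (degree `n`:
★ `refineLinear τ φ n`; a chain map by ★ `sysD_refineCochain`). [cite: StacksProject, Tag 01FG] -/
def refineComplexMap : sysComplex M ⟶ sysComplex M' where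
  f n := ModuleCat.ofHom (refineLinear τ φ n)
  comm' i j hij := by
    change i + 1 = j at hij
    subst hij
    rw [sysComplex_d, sysComplex_d]
    ext g
    change sysD M' i (refineCochain τ φ i g) = refineCochain τ φ (i + 1) (sysD M i g)
    exact sysD_refineCochain τ φ i g

/-- The components of `refineComplexMap` are the linear refinements. [cite: StacksProject, Tag 01FG] -/
@[simp] theorem refineComplexMap_f (n : ℤ) : (refineComplexMap τ φ).f n = ModuleCat.ofHom (refineLinear τ φ n) := rfl

/-- `refineComplexMap` on a cochain is `refineCochain` (the «characterised cochain map» hypothesis of the class-level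
comparison theorems). [cite: StacksProject, Tag 01FG] -/
theorem refineComplexMap_f_apply (n : ℤ) (g : SysCochain M n) :
    ((refineComplexMap τ φ).f n).hom g = refineCochain τ φ n g := rfl

/-- The refined cycle has underlying cochain `refineCochain τ φ n (ι c)`. [cite: StacksProject, Tag 01FG] -/
theorem iCycles_cyclesMap_refineComplexMap (n : ℤ) (c : (sysComplex M).cycles n) :
    ((sysComplex M').iCycles n).hom ((cyclesMap (refineComplexMap τ φ) n).hom c) =
      refineCochain τ φ n (((sysComplex M).iCycles n).hom c) := by
  change (cyclesMap (refineComplexMap τ φ) n ≫ (sysComplex M').iCycles n).hom c = _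
  rw [cyclesMap_i]
  rfl

/-- `τ^*` on the class of a cycle is the class of the refined cycle. [cite: StacksProject, Tag 01FG] -/
theorem homologyπ_refineComplexMap (n : ℤ) (c : (sysComplex M).cycles n) :
    (HomologicalComplex.homologyMap (refineComplexMap τ φ) n).hom (((sysComplex M).homologyπ n).hom c) =
      ((sysComplex M').homologyπ n).hom ((cyclesMap (refineComplexMap τ φ) n).hom c) := by
  change (((sysComplex M).homologyπ n) ≫ HomologicalComplex.homologyMap (refineComplexMap τ φ) n).hom c = _
  rw [HomologicalComplex.homologyπ_naturality]
  rfl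

end OrderedCech

end Literature.Algebra.Homology

end
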